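import Summits.QuantumAdvantage.AdviceFreeQNC0.GaugeVocab
import HarnessLib

/-!
# Cell qa-qnc0 (rung F-Q2-odd, `p = 3`): the lifted gauge resamples UNIFORMLY in the fibre of the window word

Planner qa-qnc0-p1 g16, `ROUND-15.md` §3.3–§3.4 (formalisation map L3 "Lemma K" and L4 "the lift as a
double-counting identity"), for THEOREM A′ `PredHardDWB3`.  With the lift `psi r x` of `GaugeDefs.lean`
(randomness `r = (h, ρ) : Rand`):

* `sum_table_eq` (L4, the resampling table): for fixed target words `T`, summing `Φ(ρ₀(T₀), …, ρ_m(T_m))` over all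
  tables `ρ` gives `#tables / Π_j #fib(T_j)` times the sum of `Φ` over the compatible block contents
  (`Equiv.piSplitAt` coordinatewise);
* `sum_gauge_eq` (L3, KILIAN): `h ↦ (h_j⁻¹ G_j h_{j+1})_j` is a bijection from the interior gauges `S₃^m` onto the
  tuples with the same product (`Fib`), inverse `h_i = (G_0⋯G_{i-1})⁻¹ (G'_0⋯G'_{i-1})` (`Fin.partialProd`);
* **`sum_psi_eq`** (the identity (T) of ROUND-15 §3.4): for every `F` and every pattern `x`,
  `Σ_r F(Ψ_r x) = #tables · V F x (P_win x)`, where `V F x P = Σ_{G ∈ Fib P} avg_{B ∈ Π fib(G_j)} F(glue x B)`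
  (`Vsum`) depends on `x` only through its outside bits (`Vsum_glue`).

WHAT THIS IS NOT: no counting over inputs yet (next file); separation NOT moved.
-/

noncomputable section

namespace Summit.QuantumAdvantage.AdviceFreeQNC0

namespace DWalk

open Finset Equiv
open Literature.Computability.MetaComplexity Literature.Computability.MetaComplexity.Smolensky

section Average

variable {n : ℕ} {a L m : ℕ} {κ₀ : ZMod 3}

/-! ### L4: the resampling table factorises -/

/-- The number of compatible block contents is `Π_j #fib(G_j)`, realised as the subtype-product. -/
theorem sum_BlkSet_eq_sum_pi (G : Fin (m + 1) → Perm (ZMod 3)) (Φ : (Fin (m + 1) → Fin L → Bool) → ℝ) :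
    ∑ B ∈ BlkSet L m κ₀ G, Φ B = ∑ α : ((j : Fin (m + 1)) → ↥(fib κ₀ L (G j))), Φ (fun j => (α j).1) := by
  rw [Finset.sum_subtype (BlkSet L m κ₀ G) (p := fun B => ∀ j, B j ∈ fib κ₀ L (G j))
    (fun B => by rw [mem_BlkSet]; simp only [mem_fib_iff])]
  exact Fintype.sum_equiv (Equiv.subtypePiEquivPi (p := fun j (b : Fin L → Bool) => b ∈ fib κ₀ L (G j))) _ _
    (fun B => rfl)

/-- **The table sum factorises** (L4): `(Σ_ρ Φ(ρ(T))) · Π_j #fib(T_j) = #Tbl · Σ_{B compatible with T} Φ(B)`. -/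
theorem sum_table_eq (T : Fin (m + 1) → Perm (ZMod 3)) (Φ : (Fin (m + 1) → Fin L → Bool) → ℝ) :
    (∑ ρ : Tbl L m κ₀, Φ (fun j => (ρ j (T j)).1)) * ∏ j, ((fib κ₀ L (T j)).card : ℝ) =
      (Fintype.card (Tbl L m κ₀) : ℝ) * ∑ B ∈ BlkSet L m κ₀ T, Φ B := by
  classical
  -- split every `ρ j` at `T j`
  let e : Tbl L m κ₀ ≃ ((j : Fin (m + 1)) → ↥(fib κ₀ L (T j))) ×
      ((j : Fin (m + 1)) → (g : {g : Perm (ZMod 3) // g ≠ T j}) → ↥(fib κ₀ L g.1)) :=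
    (Equiv.piCongrRight fun j => Equiv.piSplitAt (T j) (fun g => ↥(fib κ₀ L g))).trans
      (piProdSplit _ _)
  have hsum : ∑ ρ : Tbl L m κ₀, Φ (fun j => (ρ j (T j)).1) =
      ∑ p : ((j : Fin (m + 1)) → ↥(fib κ₀ L (T j))) ×
        ((j : Fin (m + 1)) → (g : {g : Perm (ZMod 3) // g ≠ T j}) → ↥(fib κ₀ L g.1)), Φ (fun j => (p.1 j).1) :=
    Fintype.sum_equiv e _ _ (fun ρ => rfl)
  have hcard : (Fintype.card (Tbl L m κ₀) : ℝ) =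
      (Fintype.card ((j : Fin (m + 1)) → ↥(fib κ₀ L (T j))) : ℝ) *
        Fintype.card ((j : Fin (m + 1)) → (g : {g : Perm (ZMod 3) // g ≠ T j}) → ↥(fib κ₀ L g.1)) := by
    rw [Fintype.card_congr e, Fintype.card_prod]; push_cast; ring
  have hA : (Fintype.card ((j : Fin (m + 1)) → ↥(fib κ₀ L (T j))) : ℝ) = ∏ j, ((fib κ₀ L (T j)).card : ℝ) := by
    rw [Fintype.card_pi]; push_cast; simp
  rw [hsum, Fintype.sum_prod_type, hcard, hA, sum_BlkSet_eq_sum_pi]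
  simp only [Finset.sum_const, Finset.card_univ, nsmul_eq_mul]
  rw [← Finset.mul_sum]
  ring

/-! ### L3: Kilian's bijection -/

/-- All boundary values of `bdry (kil G G')` are `(G_0⋯)⁻¹(G'_0⋯)`, the end ones because the products agree. -/
theorem bdry_kil (G G' : Fin (m + 1) → Perm (ZMod 3))
    (hP : Fin.partialProd G' (Fin.last (m + 1)) = Fin.partialProd G (Fin.last (m + 1))) (b : Fin (m + 2)) :
    bdry m (kil G G') b = (Fin.partialProd G b)⁻¹ * Fin.partialProd G' b := by
  unfold bdry
  split_ifs with h0 hl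
  · have : b = 0 := Fin.ext h0
    subst this; simp
  · have : b = Fin.last (m + 1) := Fin.ext (by simpa using hl)
    subst this; rw [hP]; simp
  · unfold kil
    have : (⟨(⟨b.val - 1, by omega⟩ : Fin m).val + 1, by omega⟩ : Fin (m + 2)) = b := Fin.ext (by simp; omega)
    rw [this]

/-- Interior values of `bdry h`. -/
theorem bdry_succ (h : Fin m → Perm (ZMod 3)) (i : Fin m) :
    bdry m h ⟨i.val + 1, by omega⟩ = h i := by
  unfold bdry
  rw [dif_neg (by simp), dif_neg (by simp; omega)]
  congr

/-- **Kilian (L3)**: summing over interior gauges = summing over the fibre of the product. -/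
theorem sum_gauge_eq (G : Fin (m + 1) → Perm (ZMod 3)) (Θ : (Fin (m + 1) → Perm (ZMod 3)) → ℝ) :
    ∑ h : Fin m → Perm (ZMod 3), Θ (gauged m (bdry m h) G) =
      ∑ G' ∈ Fib m (Fin.partialProd G (Fin.last (m + 1))), Θ G' := by
  refine Finset.sum_bij' (fun h _ => gauged m (bdry m h) G) (fun G' _ => kil G G') ?_ ?_ ?_ ?_ ?_
  · intro h _
    rw [mem_Fib, partialProd_gauged_bdry]
  · intro G' _; exact mem_univ _
  · -- left inverse: `kil G (gauged h) = h`
    intro h _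
    funext i
    unfold kil
    rw [partialProd_gauged, bdry_zero, inv_one, one_mul, bdry_succ]
    group
  · -- right inverse: `gauged (kil G G') = G'` on the fibre
    intro G' hG'
    rw [mem_Fib] at hG'
    funext j
    unfold gauged
    rw [bdry_kil G G' hG', bdry_kil G G' hG', Fin.partialProd_succ, Fin.partialProd_succ]
    group
  · intro h _; rfl

/-! ### The lift resamples uniformly in the fibre of the window word -/

/-- **Identity (T)** of ROUND-15 §3.4: `Σ_r F(Ψ_r x) = #Tbl · V F x (P_win x)` (`L ≥ 3` makes all fibres non-empty). -/
theorem sum_psi_eq (hκ : κ₀ ≠ 0) (hL : 3 ≤ L) (F : (Fin (n + 1) → Bool) → ℝ) (x : Fin (n + 1) → Bool) :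
    ∑ r : Rand L m κ₀, F (psi a L m κ₀ r x) =
      (Fintype.card (Tbl L m κ₀) : ℝ) * Vsum a L m κ₀ F x (Pwin a L m κ₀ x) := by
  unfold Rand
  rw [Fintype.sum_prod_type]
  simp only [psi]
  have hfac : ∀ h : Fin m → Perm (ZMod 3),
      ∑ ρ : Tbl L m κ₀, F (glue a L m x (unblk L m fun j => (ρ j (gauged m (bdry m h) (Gblk a L m κ₀ x) j)).1)) =
        (Fintype.card (Tbl L m κ₀) : ℝ) * avgB a L m κ₀ F x (gauged m (bdry m h) (Gblk a L m κ₀ x)) := by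
    intro h
    set T := gauged m (bdry m h) (Gblk a L m κ₀ x)
    have hprod : (0 : ℝ) < ∏ j, ((fib κ₀ L (T j)).card : ℝ) :=
      Finset.prod_pos fun j _ => by exact_mod_cast (fib_nonempty hκ hL (T j)).card_pos
    have h := sum_table_eq (κ₀ := κ₀) T (fun B => F (glue a L m x (unblk L m B)))
    unfold avgB
    rw [mul_div_assoc', eq_div_iff hprod.ne', ← h]
  simp only [hfac, ← Finset.mul_sum]
  congr 1
  exact sum_gauge_eq (Gblk a L m κ₀ x) (avgB a L m κ₀ F x)

/-- The number of lift randomnesses. -/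
theorem card_Rand : Fintype.card (Rand L m κ₀) = 6 ^ m * Fintype.card (Tbl L m κ₀) := by
  unfold Rand
  rw [Fintype.card_prod, Fintype.card_fun, Fintype.card_perm, ZMod.card, Fintype.card_fin]
  rfl

end Average

end DWalk

end Summit.QuantumAdvantage.AdviceFreeQNC0

end
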